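import Literature.AlgebraicGeometry.Hu2025.Statements.S01S09Interface.R110cUniversalityInterface
import Mathlib.LinearAlgebra.FiniteDimensional.Lemmas
import Mathlib.LinearAlgebra.Dimension.FreeAndStrongRankCondition
import Mathlib.LinearAlgebra.AffineSpace.AffineSubspace.Defs
import HarnessLib

/-!
# EVIDENCE (kernel), HU-R01 side note on `S01S09Interface.Prop9_1` — the LITERAL reading of [Hu25] Prop. 9.1 over every
# family with the three printed properties fails for the lane-A family (res-ref-a13 PRE-READ FLAG 2026-08-27T06:29:49Z);
# the OURS reading `Prop9_1_ours` holds for it (vacuously: the family is not realisable). res-type-024 gen 11.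

Nothing here is a statement of [Hu25]/[Hu22]; it is a kernel fact about OUR typed readings (row 110 file c, v3.3). To be filed —
only on the M-Hu lead's ask — as `Literature/AlgebraicGeometry/Hu2025/Proofs/S01S09Interface/Prop91LiteralEmptyCell.lean`
(imports `…Statements.S01S09Interface.R110cUniversalityInterface`) or deposited under HOME/ledger/evidence/HU-R01/.

* `laneAFamily : HuMatroid 3 2` — `d_I = 0` for `I ≠ [3]`, `d_[3] = 2` (the three printed properties hold);
* `laneAPlane = ⟨e₁+e₂, e₂+e₃⟩ ≤ ℚ³`, `finrank = 2`; every 2-subset `u`: `p_u ≠ 0` (`PlueckerNonzero`) and `x_u ∈ Δ_d` (`VertexMem`);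
* `¬ InStratum ℚ laneAFamily laneAPlane` (`e₁+e₂ ∈ F ∩ E_{12}` but `d_{12} = 0`);
* `not_prop9_1_laneAFamily : ¬ Prop9_1 laneAFamily`, `not_forall_prop9_1 : ¬ ∀ n d (M : HuMatroid n d), Prop9_1 M`;
* `not_isRealisable_laneAFamily`, `prop9_1_ours_laneAFamily : Prop9_1_ours laneAFamily`;
* non-vacuity: `lineFamily` (n = 2, d = 1) is realised by `diagLine = ⟨e₁+e₂⟩ ≤ ℚ²` (`isRealisable_lineFamily`), and
  `torusFreeOnCell_lineFamily : TorusFreeOnCell lineFamily`, `finrank_vectorSpan_matroidPolytope_lineFamily` (`dim Δ_d = 1`),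
  `thm9_3_torus_lineFamily : Thm9_3_torus lineFamily` (an instance of the typed Thm 9.3 clause, both sides true).
-/

namespace Literature.AlgebraicGeometry.Hu2025.Statements.S01S09Interface

open Module

/-- The lane-A family (res-ref-a13 2026-08-27T06:29:49Z): `n = 3`, `d = 2`, `d_I = 0` for `I ≠ [3]`, `d_[3] = 2`. It HAS the
three printed properties of [Hu25] chunk p0072 l.28–34 (kernel-checked here), so it is a `HuMatroid 3 2` of the literal reading.
[cite: Hu2025, §9 chunk p0072 l.28–34 (unrefereed preprint arXiv:2507.21400v1 under adjudication, D-0012/D-0089 — kernel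
support on OUR typed carriers of row 110; nothing of the source asserted)] -/
def laneAFamily : HuMatroid 3 2 where
  dI I := if I = Finset.univ then 2 else 0
  dI_empty := by decide
  dI_univ := by simp
  dI_supermod I J := by
    by_cases hI : I = Finset.univ
    · subst hI; simp
    · by_cases hJ : J = Finset.univ
      · subst hJ; simp [hI]
      · simp only [hI, hJ, if_false, Nat.zero_add]; exact Nat.zero_le _

/-- `e₁ + e₂ ∈ ℚ³`. [cite: Hu2025, §9 chunk p0072 l.71–82 (unrefereed preprint under adjudication — kernel support on OUR
typed reading; nothing of the source asserted)] -/
def laneAVec₁ : Fin 3 → ℚ := ![1, 1, 0]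

/-- `e₂ + e₃ ∈ ℚ³`. [cite: Hu2025, §9 chunk p0072 l.71–82 (unrefereed preprint under adjudication — kernel support on OUR
typed reading; nothing of the source asserted)] -/
def laneAVec₂ : Fin 3 → ℚ := ![0, 1, 1]

/-- The 2-plane `F = ⟨e₁+e₂, e₂+e₃⟩ ≤ ℚ³` of the lane-A note. [cite: Hu2025, §9 chunk p0072 l.71–82 (unrefereed preprint
under adjudication — kernel support on OUR typed reading; nothing of the source asserted)] -/
def laneAPlane : Submodule ℚ (Fin 3 → ℚ) :=
  Submodule.span ℚ (Set.range ![laneAVec₁, laneAVec₂])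

/-- `e₁+e₂`, `e₂+e₃` are linearly independent. [cite: Hu2025, §9 chunk p0072 l.71–82 (unrefereed preprint under
adjudication — kernel support on OUR typed reading; nothing of the source asserted)] -/
theorem linearIndependent_laneAVec : LinearIndependent ℚ ![laneAVec₁, laneAVec₂] := by
  rw [LinearIndependent.pair_iff]
  intro s t h
  have h0 := congr_fun h 0
  have h2 := congr_fun h 2
  simp [laneAVec₁, laneAVec₂] at h0 h2
  exact ⟨h0, h2⟩

/-- `dim_ℚ F = 2`. [cite: Hu2025, §9 chunk p0072 l.71–82 (unrefereed preprint under adjudication — kernel support on OUR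
typed reading; nothing of the source asserted)] -/
theorem finrank_laneAPlane : finrank ℚ laneAPlane = 2 := by
  rw [laneAPlane, finrank_span_eq_card linearIndependent_laneAVec]
  simp

/-- Membership in `F`: `x ∈ F ↔ x = a(e₁+e₂) + b(e₂+e₃)`. [cite: Hu2025, §9 chunk p0072 l.71–82 (unrefereed preprint under
adjudication — kernel support on OUR typed reading; nothing of the source asserted)] -/
theorem mem_laneAPlane {x : Fin 3 → ℚ} : x ∈ laneAPlane ↔ ∃ a b : ℚ, x = a • laneAVec₁ + b • laneAVec₂ := by
  rw [laneAPlane, Submodule.mem_span_range_iff_exists_fun]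
  constructor
  · rintro ⟨c, rfl⟩
    exact ⟨c 0, c 1, by simp [Fin.sum_univ_two]⟩
  · rintro ⟨a, b, rfl⟩
    exact ⟨![a, b], by simp [Fin.sum_univ_two]⟩

/-- Every 2-subset `u ⊆ [3]` satisfies `x_u ∈ Δ^{2,3}_d` for the lane-A family (`VertexMem`). [cite: Hu2025, §9 chunk p0072
l.55–60 (unrefereed preprint under adjudication — kernel support on OUR typed reading; nothing of the source asserted)] -/
theorem vertexMem_laneAFamily (u : Finset (Fin 3)) (hu : u.card = 2) : VertexMem laneAFamily u := by
  refine ⟨hu, fun I => ?_⟩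
  show (if I = Finset.univ then 2 else 0) ≤ (u ∩ I).card
  split_ifs with h
  · subst h; simp [hu]
  · exact Nat.zero_le _

/-- Every 2-subset `u ⊆ [3]` has `p_u(F) ≠ 0` for `F = ⟨e₁+e₂, e₂+e₃⟩` (the coordinate projection `F → ℚ^u` is bijective).
[cite: Hu2025, §9 chunk p0072 l.71–82 (unrefereed preprint under adjudication — kernel support on OUR typed reading; nothing
of the source asserted)] -/
theorem plueckerNonzero_laneAPlane (u : Finset (Fin 3)) (hu : u.card = 2) : PlueckerNonzero ℚ laneAPlane u := by
  let L : laneAPlane →ₗ[ℚ] (↥u → ℚ) := (LinearMap.funLeft ℚ ℚ ((↑) : ↥u → Fin 3)).comp laneAPlane.subtype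
  have hL : (fun v : laneAPlane => fun i : ↥u => (v : Fin 3 → ℚ) i) = L := rfl
  unfold PlueckerNonzero
  rw [hL]
  have hinj : Function.Injective L := by
    rw [injective_iff_map_eq_zero]
    intro v hv
    have hv' : ∀ i ∈ u, (v : Fin 3 → ℚ) i = 0 := fun i hi => congr_fun hv ⟨i, hi⟩
    obtain ⟨k, hk⟩ : ∃ k, uᶜ = {k} := Finset.card_eq_one.mp (by simp [Finset.card_compl, hu])
    have hmem : ∀ i, i ≠ k → i ∈ u := by
      intro i hik
      by_contra h
      have : i ∈ uᶜ := Finset.mem_compl.mpr h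
      rw [hk, Finset.mem_singleton] at this
      exact hik this
    obtain ⟨a, b, hab⟩ := mem_laneAPlane.mp v.2
    have e0 : (v : Fin 3 → ℚ) 0 = a := by rw [hab]; simp [laneAVec₁, laneAVec₂]
    have e1 : (v : Fin 3 → ℚ) 1 = a + b := by rw [hab]; simp [laneAVec₁, laneAVec₂]
    have e2 : (v : Fin 3 → ℚ) 2 = b := by rw [hab]; simp [laneAVec₁, laneAVec₂]
    have hab0 : a = 0 ∧ b = 0 := by
      fin_cases k
      · have h1 := hv' 1 (hmem 1 (by decide)); have h2 := hv' 2 (hmem 2 (by decide))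
        rw [e1] at h1; rw [e2] at h2; constructor <;> linarith
      · have h0 := hv' 0 (hmem 0 (by decide)); have h2 := hv' 2 (hmem 2 (by decide))
        rw [e0] at h0; rw [e2] at h2; exact ⟨h0, h2⟩
      · have h0 := hv' 0 (hmem 0 (by decide)); have h1 := hv' 1 (hmem 1 (by decide))
        rw [e0] at h0; rw [e1] at h1; constructor <;> linarith
    obtain ⟨rfl, rfl⟩ := hab0
    apply Subtype.ext
    rw [hab]; simp
  have hdim : finrank ℚ laneAPlane = finrank ℚ (↥u → ℚ) := by
    rw [finrank_laneAPlane, Module.finrank_fintype_fun_eq_card, Fintype.card_coe, hu]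
  exact ⟨hinj, (LinearMap.injective_iff_surjective_of_finrank_eq_finrank hdim).1 hinj⟩

/-- `F = ⟨e₁+e₂, e₂+e₃⟩` is NOT in the cell of the lane-A family: `d_{12} = 0` while `e₁+e₂ ∈ F ∩ E_{12}`.
[cite: Hu2025, §9 chunk p0072 l.24–28 (unrefereed preprint under adjudication — kernel support on OUR typed reading; nothing
of the source asserted)] -/
theorem not_inStratum_laneAFamily_laneAPlane : ¬ InStratum ℚ laneAFamily laneAPlane := by
  rintro ⟨-, h⟩
  have h01 := h {0, 1}
  have hd : laneAFamily.dI {0, 1} = 0 := by decide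
  rw [hd, Submodule.finrank_eq_zero] at h01
  have hv : laneAVec₁ ∈ laneAPlane ⊓ coordSubspace ℚ ({0, 1} : Finset (Fin 3)) := by
    refine Submodule.mem_inf.mpr ⟨mem_laneAPlane.mpr ⟨1, 0, by simp⟩, ?_⟩
    rw [coordSubspace, Submodule.mem_pi]
    intro i hi
    fin_cases i <;> simp_all [laneAVec₁]
  rw [h01, Submodule.mem_bot] at hv
  have := congr_fun hv 0
  simp [laneAVec₁] at this

/-- **The literal reading of Prop. 9.1 fails for the lane-A family.** [cite: Hu2025, Proposition 9.1 chunk p0072 l.71–82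
(unrefereed preprint arXiv:2507.21400v1 under adjudication, D-0012/D-0089 — kernel support on OUR typed reading `Prop9_1`;
nothing of the source asserted)] -/
theorem not_prop9_1_laneAFamily : ¬ Prop9_1 laneAFamily := by
  intro h
  have key := h ℚ laneAPlane finrank_laneAPlane
  exact not_inStratum_laneAFamily_laneAPlane
    (key.mpr fun u hu => iff_of_true (plueckerNonzero_laneAPlane u hu) (vertexMem_laneAFamily u hu))

/-- Hence the literal reading is not a property of every family with the three printed properties.
[cite: Hu2025, Proposition 9.1 chunk p0072 l.71–82 (unrefereed preprint under adjudication — kernel support on OUR typed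
reading; nothing of the source asserted)] -/
theorem not_forall_prop9_1 : ¬ ∀ (n d : ℕ) (M : HuMatroid n d), Prop9_1 M :=
  fun h => not_prop9_1_laneAFamily (h 3 2 _)

/-- The lane-A family indexes NO occurring stratum: over any field, a 2-plane `F₀ ≤ K₀³` meets `E_{12}` non-trivially
(the third coordinate `F₀ → K₀` has a kernel of dimension ≥ 1), so `dim(F₀ ∩ E_{12}) = d_{12} = 0` is impossible.
[cite: Hu2025, §9 chunk p0072 l.24–28 (unrefereed preprint under adjudication — kernel support on OUR typed reading
`HuMatroid.IsRealisable`; nothing of the source asserted)] -/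
theorem not_isRealisable_laneAFamily : ¬ laneAFamily.IsRealisable := by
  rintro ⟨K₀, _instK₀, F₀, hfin, h⟩
  have h01 := h {0, 1}
  have hd : laneAFamily.dI {0, 1} = 0 := by decide
  rw [hd, Submodule.finrank_eq_zero] at h01
  -- the third coordinate on F₀
  let φ : F₀ →ₗ[K₀] K₀ := (LinearMap.proj (2 : Fin 3)).comp F₀.subtype
  have hrange : finrank K₀ (LinearMap.range φ) ≤ 1 := by
    calc finrank K₀ (LinearMap.range φ) ≤ finrank K₀ K₀ := Submodule.finrank_le _
      _ = 1 := Module.finrank_self K₀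
  have hker : 1 ≤ finrank K₀ (LinearMap.ker φ) := by
    have := LinearMap.finrank_range_add_finrank_ker φ
    rw [hfin] at this
    omega
  have hker' : LinearMap.ker φ ≠ ⊥ := by
    intro hbot
    rw [hbot, finrank_bot] at hker
    exact Nat.not_succ_le_zero 0 hker
  obtain ⟨v, hvker, hv0⟩ := (Submodule.ne_bot_iff _).mp hker'
  have hv2 : (v : Fin 3 → K₀) 2 = 0 := by simpa [φ] using hvker
  have hvmem : (v : Fin 3 → K₀) ∈ F₀ ⊓ coordSubspace K₀ ({0, 1} : Finset (Fin 3)) := by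
    refine Submodule.mem_inf.mpr ⟨v.2, ?_⟩
    rw [coordSubspace, Submodule.mem_pi]
    intro i hi
    fin_cases i <;> simp_all
  rw [h01, Submodule.mem_bot] at hvmem
  exact hv0 (Subtype.ext hvmem)

/-- … so the OURS reading `Prop9_1_ours` holds for the lane-A family (vacuously) — the two typed readings differ exactly on
the non-occurring families. [cite: Hu2025, Proposition 9.1 chunk p0072 l.71–82 with l.24–28 (unrefereed preprint under
adjudication — kernel support on OUR typed readings; nothing of the source asserted)] -/
theorem prop9_1_ours_laneAFamily : Prop9_1_ours laneAFamily :=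
  fun h => (not_isRealisable_laneAFamily h).elim

/-! ## Non-vacuity of the OURS antecedent: a realised family (`n = 2`, `d = 1`, the line `⟨e₁+e₂⟩ ≤ ℚ²`) -/

/-- The family of the line `⟨e₁+e₂⟩ ≤ K²`: `d_I = 1` if `I = [2]`, else `0` (three printed properties hold).
[cite: Hu2025, §9 chunk p0072 l.24–28, l.71–82 (unrefereed preprint arXiv:2507.21400v1 under adjudication, D-0012/D-0089 — kernel support on OUR typed carriers of row 110; nothing of the source asserted)] -/
def lineFamily : HuMatroid 2 1 where
  dI I := if I = Finset.univ then 1 else 0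
  dI_empty := by decide
  dI_univ := by simp
  dI_supermod I J := by
    by_cases hI : I = Finset.univ
    · subst hI; simp
    · by_cases hJ : J = Finset.univ
      · subst hJ; simp [hI]
      · simp only [hI, hJ, if_false, Nat.zero_add]; exact Nat.zero_le _

/-- `e₁ + e₂ ∈ ℚ²`. [cite: Hu2025, §9 chunk p0072 l.24–28, l.71–82 (unrefereed preprint arXiv:2507.21400v1 under adjudication, D-0012/D-0089 — kernel support on OUR typed carriers of row 110; nothing of the source asserted)] -/
def diagVec : Fin 2 → ℚ := ![1, 1]

/-- The line `⟨e₁+e₂⟩ ≤ ℚ²`. [cite: Hu2025, §9 chunk p0072 l.24–28, l.71–82 (unrefereed preprint arXiv:2507.21400v1 under adjudication, D-0012/D-0089 — kernel support on OUR typed carriers of row 110; nothing of the source asserted)] -/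
def diagLine : Submodule ℚ (Fin 2 → ℚ) := ℚ ∙ diagVec

/-- `⟨e₁+e₂⟩` lies in the cell of `lineFamily`: `dim = 1`, `dim(⟨e₁+e₂⟩ ∩ E_I) = 0` for `I ≠ [2]`.
[cite: Hu2025, §9 chunk p0072 l.24–28, l.71–82 (unrefereed preprint arXiv:2507.21400v1 under adjudication, D-0012/D-0089 — kernel support on OUR typed carriers of row 110; nothing of the source asserted)] -/
theorem inStratum_lineFamily_diagLine : InStratum ℚ lineFamily diagLine := by
  have hv : diagVec ≠ 0 := by
    intro h; have := congr_fun h 0; simp [diagVec] at this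
  refine ⟨finrank_span_singleton hv, fun I => ?_⟩
  show Module.finrank ℚ ↥(diagLine ⊓ coordSubspace ℚ I) = (if I = Finset.univ then 1 else 0)
  by_cases hI : I = Finset.univ
  · subst hI
    have htop : coordSubspace ℚ (Finset.univ : Finset (Fin 2)) = ⊤ := by
      rw [eq_top_iff]
      intro v _
      rw [coordSubspace, Submodule.mem_pi]
      intro i hi
      simp at hi
    rw [if_pos rfl, htop, inf_top_eq]
    exact finrank_span_singleton hv
  · rw [if_neg hI, Submodule.finrank_eq_zero, eq_bot_iff]
    intro v hv'
    obtain ⟨hvF, hvE⟩ := Submodule.mem_inf.mp hv'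
    obtain ⟨i, hi⟩ : ∃ i : Fin 2, i ∉ I := by
      by_contra h
      push Not at h
      exact hI (Finset.eq_univ_of_forall h)
    rw [coordSubspace, Submodule.mem_pi] at hvE
    have hvi : v i = 0 := hvE i (by simpa using hi)
    obtain ⟨a, rfl⟩ := Submodule.mem_span_singleton.mp hvF
    have ha : a = 0 := by
      fin_cases i <;> simpa [diagVec] using hvi
    subst ha
    simp

/-- **`lineFamily` is realised** — so the antecedent of `Prop9_1_ours` is inhabited and the OURS reading is not vacuous;
with `Prop9_1_ours_holds` (file `Prop91Ours.lean`) `Prop9_1 lineFamily` holds.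
[cite: Hu2025, §9 chunk p0072 l.24–28, l.71–82 (unrefereed preprint arXiv:2507.21400v1 under adjudication, D-0012/D-0089 — kernel support on OUR typed carriers of row 110; nothing of the source asserted)] -/
theorem isRealisable_lineFamily : lineFamily.IsRealisable :=
  ⟨ℚ, inferInstance, diagLine, inStratum_lineFamily_diagLine⟩

/-! ## `TorusFreeOnCell` holds for the realised family `lineFamily` (non-vacuity of Thm 9.3 / 9.4's freeness clause) -/

/-- **`TorusFreeOnCell` is not vacuous and holds in an instance**: for the realised family `lineFamily` (`n = 2`, `d = 1`) the
torus `(K^×)²/K^×` acts freely on the cell at every field-valued point: a line `F = ⟨w⟩ ≤ K²` in the cell has `w₁ w₂ ≠ 0`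
(`F ∩ E_1 = F ∩ E_2 = 0`), so `t • F ⊆ F` forces `t₁ = t₂`. (Consistent with Thm 9.3's torus clause: `Δ_d` is the
segment `[e₁, e₂]`, of dimension `1 = n − 1`; that side is not proved here.)
[cite: Hu2025, Thm 9.3 / 9.4 chunk p0072 l.106–124 (unrefereed preprint arXiv:2507.21400v1 under adjudication, D-0012/D-0089
— kernel support on OUR typed reading `TorusFreeOnCell`; nothing of the source asserted)] -/
theorem torusFreeOnCell_lineFamily : TorusFreeOnCell lineFamily := by
  intro K _ F hF t ht
  obtain ⟨hF1, hFI⟩ := hF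
  -- F = ⟨w⟩ with w ≠ 0
  haveI : Module.Free K F := Module.Free.of_divisionRing K F
  obtain ⟨w, hw0, hw⟩ := finrank_eq_one_iff'.mp hF1
  -- both coordinates of w are non-zero: otherwise w ∈ F ∩ E_{other}, whose dimension is d_I = 0
  have hcoord : ∀ i : Fin 2, (w : Fin 2 → K) i ≠ 0 := by
    intro i hi
    -- I := {j | j ≠ i} = univ.erase i : w is supported on I
    have hI : lineFamily.dI (Finset.univ.erase i) = 0 := by
      show (if Finset.univ.erase i = Finset.univ then 1 else 0) = 0
      rw [if_neg]
      intro h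
      have := Finset.ext_iff.mp h i
      simp at this
    have hfin := hFI (Finset.univ.erase i)
    rw [hI, Submodule.finrank_eq_zero] at hfin
    have hmem : (w : Fin 2 → K) ∈ F ⊓ coordSubspace K (Finset.univ.erase i) := by
      refine Submodule.mem_inf.mpr ⟨w.2, ?_⟩
      rw [coordSubspace, Submodule.mem_pi]
      intro j hj
      have : j = i := by simpa using hj
      subst this
      simpa using hi
    rw [hfin, Submodule.mem_bot] at hmem
    exact hw0 (Subtype.ext hmem)
  -- t • w ∈ F = ⟨w⟩ gives t • w = c • w
  have htw := ht (w : Fin 2 → K) w.2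
  obtain ⟨c, hc⟩ := hw ⟨_, htw⟩
  have hc' : ∀ i : Fin 2, c * (w : Fin 2 → K) i = (t i : K) * (w : Fin 2 → K) i := by
    intro i
    have := congr_arg (fun v : F => (v : Fin 2 → K) i) hc
    simpa using this
  have hti : ∀ i : Fin 2, (t i : K) = c := fun i =>
    (mul_right_cancel₀ (hcoord i) (hc' i)).symm
  intro α β
  exact Units.ext (by rw [hti α, hti β])


/-! ## … and Thm 9.3's torus clause holds for `lineFamily` (`dim_ℝ Δ_d = 1 = n − 1`) -/

/-- The matroid subpolytope of `lineFamily` is the segment `{(s, 1 − s) ∣ 0 ≤ s ≤ 1} = Δ^{1,2}` (only the `I = [2]`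
constraint is non-trivial). [cite: Hu2025, §9 chunk p0072 l.55–60 (unrefereed preprint arXiv:2507.21400v1 under adjudication,
D-0012/D-0089 — kernel support on OUR typed carriers of row 110; nothing of the source asserted)] -/
theorem mem_matroidPolytope_lineFamily_iff (x : Fin 2 → ℝ) :
    x ∈ matroidPolytope lineFamily ↔ (∀ α, 0 ≤ x α ∧ x α ≤ 1) ∧ x 0 + x 1 = 1 := by
  simp only [matroidPolytope, hypersimplex, Set.mem_setOf_eq, Fin.sum_univ_two, Nat.cast_one]
  constructor
  · rintro ⟨⟨h01, hs⟩, -⟩; exact ⟨h01, hs⟩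
  · rintro ⟨h01, hs⟩
    refine ⟨⟨h01, hs⟩, fun I => ?_⟩
    show ((if I = Finset.univ then 1 else 0 : ℕ) : ℝ) ≤ ∑ α ∈ I, x α
    split_ifs with hI
    · subst hI; simp [Fin.sum_univ_two, hs]
    · simp only [Nat.cast_zero]; exact Finset.sum_nonneg fun α _ => (h01 α).1

/-- `dim_ℝ Δ^{1,2}_{lineFamily} = 1 = n − 1` (the affine span of the segment `[e₁, e₂]` has direction `ℝ·(e₁ − e₂)`).
[cite: Hu2025, Thm 9.3 chunk p0072 l.106–115 (unrefereed preprint under adjudication — kernel support on OUR typed carriers;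
nothing of the source asserted)] -/
theorem finrank_vectorSpan_matroidPolytope_lineFamily :
    Module.finrank ℝ ↥(vectorSpan ℝ (matroidPolytope lineFamily)) = 1 := by
  let v : Fin 2 → ℝ := ![1, -1]
  have hv0 : v ≠ 0 := by intro h; have := congr_fun h 0; simp [v] at this
  apply le_antisymm
  · have hle : vectorSpan ℝ (matroidPolytope lineFamily) ≤ ℝ ∙ v := by
      rw [vectorSpan_def, Submodule.span_le]
      rintro _ ⟨p, hp, q, hq, rfl⟩
      rw [mem_matroidPolytope_lineFamily_iff] at hp hq
      rw [SetLike.mem_coe, Submodule.mem_span_singleton]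
      refine ⟨p 0 - q 0, ?_⟩
      funext i
      fin_cases i
      · simp [v]
      · simp [v]; linarith [hp.2, hq.2]
    calc Module.finrank ℝ ↥(vectorSpan ℝ (matroidPolytope lineFamily))
        ≤ Module.finrank ℝ ↥(ℝ ∙ v) := Submodule.finrank_mono hle
      _ = 1 := finrank_span_singleton hv0
  · rw [Submodule.one_le_finrank_iff]
    intro hbot
    have h1 : (![1, 0] : Fin 2 → ℝ) ∈ matroidPolytope lineFamily := by
      rw [mem_matroidPolytope_lineFamily_iff]; refine ⟨fun α => ?_, by simp⟩; fin_cases α <;> simp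
    have h2 : (![0, 1] : Fin 2 → ℝ) ∈ matroidPolytope lineFamily := by
      rw [mem_matroidPolytope_lineFamily_iff]; refine ⟨fun α => ?_, by simp⟩; fin_cases α <;> simp
    have h12 := vsub_mem_vectorSpan ℝ h1 h2
    rw [hbot, Submodule.mem_bot] at h12
    have := congr_fun h12 0
    simp at this

/-- **Thm 9.3's torus clause HOLDS for the realised family `lineFamily`** (both sides true: `torusFreeOnCell_lineFamily`
and `dim_ℝ Δ_d = 1 = n − 1`) — a non-vacuous instance of the typed `Thm9_3_torus` / `Thm9_3`.
[cite: Hu2025, Thm 9.3 chunk p0072 l.106–115 (unrefereed preprint arXiv:2507.21400v1 under adjudication, D-0012/D-0089 —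
kernel support on OUR typed reading; nothing of the source asserted)] -/
theorem thm9_3_torus_lineFamily : Thm9_3_torus lineFamily :=
  iff_of_true torusFreeOnCell_lineFamily (by rw [finrank_vectorSpan_matroidPolytope_lineFamily])


end Literature.AlgebraicGeometry.Hu2025.Statements.S01S09Interface
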